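import Summits.HodgeConjecture.HodgeConjecture.Theorems.WeilTypeLadderOnPath
import Literature.AlgebraicGeometry.HodgeTheory.WeilClassesSixfoldsSqrtMinus3Schoen
import HarnessLib

/-!
# WeilTypeLadder · the `d = 3` slice of the sixfold rung R1 on a REFEREED floor: Schoen 1998 ∧ R1′[d = 3] ⟹ all `√-3`-sixfolds

b2b cell `hweil` (packet `run/shared/lean/b2b/hodge-weil/`). Prover 2, generation 2. The joint
`WTL.weilSixfolds_of_nonsplitSixfolds_of_floor : [Markman 2025, Thm 1.5.1] → R1′ → R1` (`Theorems/WeilTypeLadderOnPath.lean`)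
rests on the UNREFEREED floor F0a. At `K = ℚ(√-3)` the floor has a REFEREED substitute: the named fact
`Schoen1998_weilClasses_algebraic_hyperbolicSixfold_three` (`Literature/…/WeilClassesSixfoldsSqrtMinus3Schoen.lean`; Schoen,
Compositio 114 (1998) §§11–13: "the Weil cohomology of every fiber of the 'universal' family (12.1) is generated by
classes of algebraic cycles", the family being the SPLIT `√-3` component — prover 3 gen 2's discriminant correction).
This file records the `d = 3` slices: Schoen 1998 ∧ R1′|_{d=3} ⟹ Weil classes algebraic on EVERY complex abelian sixfold
with `φ ≫ φ = -3` (case split on the existence of a hyperbolic `K`-symmetrised hyperplane class), and the on-path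
form (the comparison edge floor ⟹ Schoen's statement is the Literature lemma `…_of_markman`). CONDITIONAL on the refereed fact and on the open rung R1′; sorry-free; no definition.
-/

-- every declaration of this problem lives in `Summit.HodgeConjecture.HodgeConjecture.…` (summit = sub-problem)
set_option linter.dupNamespace false

noncomputable section

open CategoryTheory

namespace Summit.HodgeConjecture.HodgeConjecture.WeilTypeLadder

open Literature.AlgebraicGeometry Literature.AlgebraicGeometry.Motives
open Literature.AlgebraicGeometry.HodgeTheory
open Literature.AlgebraicTopology.SingularHomology

/-- **The `d = 3` slice of R1′** (`NonsplitSixfolds` at `K = ℚ(√-3)`), as a standalone `Prop`-free statement: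
extracted from R1′ by instantiation. [folklore] -/
theorem nonsplitSixfolds_three (h : NonsplitSixfolds) :
    ∀ (A : Motives.AbelianVariety ℂ) (φ : A ⟶ A), A.dim = 2 * 3 →
      Motives.IsSmoothProjective (2 * 3) A.X → φ ≫ φ = -((3 : ℕ) • 𝟙 A) →
        (∀ (e : Motives.ProjectiveEmbedding A.X) (a : complexBetti (Motives.projectiveSpace e.n ℂ) 2),
          IsRationalClass a → a ≠ 0 →
            ¬ Motives.IsHyperbolicWeilType A φ 3
              ((((3 : ℕ) : ℂ)) • complexBetti.map e.ι 2 a +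
                complexBetti.map φ.hom.hom.hom 2 (complexBetti.map e.ι 2 a))) →
          ∀ c : complexBetti A.X (2 * 3), IsRationalClass c → IsOfHodgeType (2 * 3) A.X (2 * 3) 3 3 c →
            c ∈ weilClassesOf A φ 3 3 → c ∈ algebraicClasses A.X 3 :=
  h 3 (by norm_num)

/-- **All `√-3`-sixfolds from Schoen 1998 (split, REFEREED) and R1′[d = 3] (non-split, OPEN).** For every complex
abelian sixfold `(A, φ)` with `φ ≫ φ = -3`, every rational `(3,3)` class of `weilClassesOf A φ 3 3` is algebraic, GRANTED
the named fact `Schoen1998_weilClasses_algebraic_hyperbolicSixfold_three` and the rung `NonsplitSixfolds`: by cases on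
whether some `K`-symmetrised hyperplane class `3·e^*a + φ^*e^*a` is hyperbolic. The `d = 3` slice of
`weilSixfolds_of_nonsplitSixfolds_of_floor` with Markman's unrefereed fact replaced by Schoen's refereed one.
[cite: Schoen1998HodgeWeilAddendum, §§11–13] [cite: Markman2025SurveySecant, §11.5 Step 1] -/
theorem weilClasses_sixfold_three_algebraic_of_schoen1998_of_nonsplitSixfolds
    (hS : Schoen1998_weilClasses_algebraic_hyperbolicSixfold_three) (h : NonsplitSixfolds) :
    ∀ (A : Motives.AbelianVariety ℂ) (φ : A ⟶ A), A.dim = 2 * 3 →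
      Motives.IsSmoothProjective (2 * 3) A.X → φ ≫ φ = -((3 : ℕ) • 𝟙 A) →
        ∀ c : complexBetti A.X (2 * 3), IsRationalClass c → IsOfHodgeType (2 * 3) A.X (2 * 3) 3 3 c →
          c ∈ weilClassesOf A φ 3 3 → c ∈ algebraicClasses A.X 3 := by
  intro A φ hA hX hφ c hc h33 hW
  by_cases hhyp : ∃ (e : Motives.ProjectiveEmbedding A.X) (a : complexBetti (Motives.projectiveSpace e.n ℂ) 2),
      IsRationalClass a ∧ a ≠ 0 ∧
        Motives.IsHyperbolicWeilType A φ 3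
          ((((3 : ℕ) : ℂ)) • complexBetti.map e.ι 2 a + complexBetti.map φ.hom.hom.hom 2 (complexBetti.map e.ι 2 a))
  · obtain ⟨e, a, ha, ha0, hh⟩ := hhyp
    exact hS A φ hA hX hφ e a ha ha0 hh c hc h33 hW
  · push Not at hhyp
    exact nonsplitSixfolds_three h A φ hA hX hφ (fun e a ha ha0 ↦ hhyp e a ha ha0) c hc h33 hW

/-- **Under the Hodge conjecture** the same `d = 3` statement holds with no fact (on-path form; both hypotheses of the
previous theorem are cases of HC: `nonsplitSixfolds_of_hodgeConjecture` and
`Schoen1998_weilClasses_algebraic_hyperbolicSixfold_three_of_hodgeConjectureFor`). [cite: Deligne2000, §1] -/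
theorem weilClasses_sixfold_three_algebraic_of_hodgeConjecture (h : _root_.HodgeConjecture) :
    ∀ (A : Motives.AbelianVariety ℂ) (φ : A ⟶ A), A.dim = 2 * 3 →
      Motives.IsSmoothProjective (2 * 3) A.X → φ ≫ φ = -((3 : ℕ) • 𝟙 A) →
        ∀ c : complexBetti A.X (2 * 3), IsRationalClass c → IsOfHodgeType (2 * 3) A.X (2 * 3) 3 3 c →
          c ∈ weilClassesOf A φ 3 3 → c ∈ algebraicClasses A.X 3 :=
  fun _ _ _ hX _ c hc h33 _ ↦ (h hX).2 3 c hc h33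

end Summit.HodgeConjecture.HodgeConjecture.WeilTypeLadder

end
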